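import Summits.AtomisticToContinuum.FouriersLaw.Theorems.BondHeatUncertaintyExtensiveSnapshotIrreversibilityEnergyWindowHessianSplitB

/-!
# Crux `ExtensiveSnapshotIrreversibility` (stmt-AtomisticToContinuum-9121): the far-side Duhamel split beneath S3, part C — the common density leaf (KD₂) beneath (G2) and (G12*ᶜᶜ)
Cell decomp-a2c, lens «grading / quantitative ladder», generation 82, part C of the node
«HessianSplit» (parts A, main, B); critic row 1161, order (c′).
CONTENTS.  Both open leaves of the record — the near-side smoothing bound (G2)
`EqualTemperatureBathHessian` (equal temperatures, departure bath momentum) and the far-side compact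
class (G12*ᶜᶜ) `PerturbedKernelHessianIBPCompact` (two temperatures, arrival bath momentum) — are
statements about ONE object: the jointly smooth transition density `p^δ(s, x, y)` of the tree
(`IsTransitionDensity`, CEHR Prop. 3.2 from Hörmander's theorem) at a FIXED time `s ∈ [½, 1]`.
§1 types the common, Malliavin-free leaf (KD₂) `LyapunovWeightedDensitySobolev₂`: for `|δ| < δ₀`
(so `δ = 0` is included), `s ∈ [½, 1]`, a bath site `b` and every `z`,
`∫ e^{θ₁H(y)} (|∂_{x_b}p| + |∂²_{x_b}p| + |∂_{y_b}p| + |∂²_{y_b}p|)(s, z, y) dy ≤ C e^{θ₂H(z)}` —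
the Lyapunov-weighted `W^{2,1}` size of the density in the departure and arrival bath momenta, NO
rate in `s`.  §3: ★ `perturbedKernelHessianIBPCompact_of_densitySobolev₂ : (KD₂) → (G12*ᶜᶜ)`
(two integrations by parts against the smooth density; every integrability from the compact support
of the observable).  §4: ★ `equalTemperatureBathHessian_of_densitySobolev₂ : (KD₂) → (G2)` (the
second derivative of `w ↦ ∫ p(r, w, y) h(y) dy` under the integral sign by
`Literature.Analysis.FunctionSpaces.iteratedFDeriv_integral_of_dominated`, local domination on
`tsupport h × B̄(w₀, 1)`, and `∂_{p_b}∂_{p_b} f = D²f(v, v)`, `v = (0, e_b)`).  §5: the junctions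
★ `kernelTemperatureLipschitz_of_densitySobolev₂ : (Dˢ) → (KD₂) → S3` and
`snapshotKLUpperExpansion_of_atoms₆KD : A0 → A2 → (Dˢ) → (KD₂) → A3p → A4 → K_fix`.
0 sorry; standard axioms.

References: N. Cuneo, J.-P. Eckmann, M. Hairer, L. Rey-Bellet, EJP 23 (2018) no. 55, §3 (3.4),
Prop. 3.2; M. Hairer, J. C. Mattingly, EJP 16 (2011) 658–738, Thm 6.7; D. Nualart, The Malliavin
Calculus and Related Topics (2006), Prop 2.1.4, §2.3; L. Hörmander, ALPDO I, Thm 1.1.9.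
-/

noncomputable section

namespace Summit.AtomisticToContinuum.FouriersLaw.Theorems.ExtensiveSnapshotIrreversibility.EnergyWindow

open MeasureTheory Filter Topology Real Set Metric
open scoped ENNReal NNReal ContDiff
open Literature.MathematicalPhysics.KineticTheory.HeatConduction Literature.Probability.Process
open Literature.Analysis.FunctionSpaces

/-! ## 1. (KD₂): the Lyapunov-weighted `W^{2,1}` bound of the smooth density at a fixed time -/

/-- The four-term integrand of (KD₂): `|∂_{x_b} p(s,·,y)(z)| + |∂²_{x_b} p(s,·,y)(z)| +
|∂_{y_b} p(s,z,·)(y)| + |∂²_{y_b} p(s,z,·)(y)|` (departure and arrival bath momentum). [folklore] -/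
def densitySobolevSum₂ {N : ℕ} (p : ℝ → PhaseSpace N → PhaseSpace N → ℝ) (s : ℝ) (b : Fin N)
    (z y : PhaseSpace N) : ℝ :=
  |partialP b (fun x => p s x y) z| + |partialP b (partialP b fun x => p s x y) z| +
    |partialP b (p s z) y| + |partialP b (partialP b (p s z)) y|

/-- **(KD₂) `LyapunovWeightedDensitySobolev₂`** (after (G2) `EqualTemperatureBathHessian` and (G12*ᶜᶜ) `PerturbedKernelHessianIBPCompact`)[route leaf beneath (G2) ∧ (G12*ᶜᶜ), K_fix half of stmt-9121]:
for positive parameters, `T > 0`, `N ≥ 2` and rates `0 < θ₁ < θ₂ < 1/T` there are `δ₀ > 0` and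
`C` such that for every `|δ| < δ₀` (in particular `δ = 0`), every jointly smooth density `p` of the
kernels with baths `T ± δ/2` (`IsTransitionDensity`), every FIXED time `s ∈ [½, 1]`, both bath
`b`, all `z`: `y ↦ e^{θ₁H(y)} (|∂_{x_b}p| + |∂²_{x_b}p| + |∂_{y_b}p| + |∂²_{y_b}p|)(s,z,y)`
is Lebesgue integrable with integral `≤ C e^{θ₂H(z)}` — the Lyapunov-weighted `W^{2,1}` bound of
the hypoelliptic density in the bath momenta at a positive time, uniform in the temperature
perturbation; NO short-time rate (order `0` is CEHR (3.4), in the tree).  Truth sketch: first-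
and second-order Bismut–Malliavin integration by parts at time `s ≥ ½` (inverse moments of the
Malliavin matrix with Lyapunov control `e^{εH}`, Hairer–Mattingly Thm 6.7 shape; Kusuoka–Stroock
weights of order `≤ 2`), Hölder with CEHR (3.4).  [NEW · WEAKER · ATTACKABLE-L]
(after CuneoEckmannHairerReyBellet2018, §3 eq. (3.4), Prop. 3.2) [route leaf · named hypothesis of this cell, NOT filed as a literature fact] -/
def LyapunovWeightedDensitySobolev₂ : Prop :=
  ∀ ω₂ lam β γ : ℝ, 0 < ω₂ → 0 < lam → 0 < β → 0 < γ →
    ∀ T : ℝ, 0 < T → ∀ (N : ℕ) (hN : 2 ≤ N), ∀ θ₁ θ₂ : ℝ, 0 < θ₁ → θ₁ < θ₂ → θ₂ < 1 / T →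
      ∃ δ₀ C : ℝ, 0 < δ₀ ∧ ∀ δ : ℝ, |δ| < δ₀ →
        ∀ p : ℝ → PhaseSpace N → PhaseSpace N → ℝ,
          IsTransitionDensity ω₂ lam β γ N (T + δ / 2) (T - δ / 2) p →
          ∀ s : ℝ, 1 / 2 ≤ s → s ≤ 1 → ∀ b : Fin N, (b = leftBath N hN ∨ b = rightBath N hN) →
            ∀ z : PhaseSpace N,
              Integrable (fun y => Real.exp (θ₁ * (pinnedChain ω₂ lam β γ).hamiltonian N y) *
                densitySobolevSum₂ p s b z y) ∧
              ∫ y, Real.exp (θ₁ * (pinnedChain ω₂ lam β γ).hamiltonian N y) *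
                  densitySobolevSum₂ p s b z y ≤
                C * Real.exp (θ₂ * (pinnedChain ω₂ lam β γ).hamiltonian N z)

/-! ## 2. Calculus and bookkeeping -/

section Calculus

variable {N : ℕ}

/-- Extraction of one term from a weighted bound of a sum: if `E·S` is integrable with
`∫ E S ≤ B`, `0 ≤ f ≤ S`, `0 ≤ E` and `E·f` is measurable then `E·f` is integrable with
`∫ E f ≤ B`. [folklore] -/
theorem integrable_and_integral_le_of_le {α : Type*} [MeasurableSpace α] {μ : Measure α}
    {E f S : α → ℝ} {B : ℝ} (hS : Integrable (fun y => E y * S y) μ)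
    (hB : ∫ y, E y * S y ∂μ ≤ B) (hE : ∀ y, 0 ≤ E y) (hf0 : ∀ y, 0 ≤ f y)
    (hfS : ∀ y, f y ≤ S y) (hm : AEStronglyMeasurable (fun y => E y * f y) μ) :
    Integrable (fun y => E y * f y) μ ∧ ∫ y, E y * f y ∂μ ≤ B := by
  have hle : ∀ y, ‖E y * f y‖ ≤ E y * S y := fun y => by
    rw [Real.norm_eq_abs, abs_of_nonneg (mul_nonneg (hE y) (hf0 y))]
    exact mul_le_mul_of_nonneg_left (hfS y) (hE y)
  have hi : Integrable (fun y => E y * f y) μ := hS.mono' hm (Eventually.of_forall hle)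
  exact ⟨hi, (integral_mono hi hS fun y => le_trans (le_abs_self _) (hle y)).trans hB⟩

/-- Each of the last three terms of `densitySobolevSum₂` is bounded by the sum. -/
theorem le_densitySobolevSum₂ (p : ℝ → PhaseSpace N → PhaseSpace N → ℝ) (s : ℝ) (b : Fin N)
    (z y : PhaseSpace N) :
    |partialP b (partialP b fun x => p s x y) z| ≤ densitySobolevSum₂ p s b z y ∧
      |partialP b (p s z) y| ≤ densitySobolevSum₂ p s b z y ∧
      |partialP b (partialP b (p s z)) y| ≤ densitySobolevSum₂ p s b z y := by
  unfold densitySobolevSum₂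
  refine ⟨?_, ?_, ?_⟩ <;>
  linarith [abs_nonneg (partialP b (fun x => p s x y) z), abs_nonneg (partialP b (p s z) y),
    abs_nonneg (partialP b (partialP b fun x => p s x y) z),
    abs_nonneg (partialP b (partialP b (p s z)) y)]

/-- `∂_{p_b}∂_{p_b} f (w) = D²f(w)(v, v)`, `v = (0, e_b)`, for `f ∈ C²`. [folklore] -/
theorem partialP_partialP_eq_iteratedFDeriv (b : Fin N) {f : PhaseSpace N → ℝ}
    (hf : ContDiff ℝ 2 f) (w : PhaseSpace N) :
    partialP b (partialP b f) w =
      iteratedFDeriv ℝ 2 f w ![((0, Pi.single b 1) : PhaseSpace N), (0, Pi.single b 1)] := by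
  have hd : Differentiable ℝ f := hf.differentiable (by norm_num)
  have hd1 : Differentiable ℝ (partialP b f) :=
    (contDiff_one_partialP_of_contDiff_two b hf).differentiable one_ne_zero
  have hc : DifferentiableAt ℝ (fderiv ℝ f) w :=
    ((hf.fderiv_right (m := 1) (by norm_num)).differentiable one_ne_zero) w
  rw [iteratedFDeriv_two_apply, partialP_eq_fderiv hd1 b]
  simp only [Matrix.cons_val_zero, Matrix.cons_val_one]
  rw [partialP_eq_fderiv hd b, fderiv_clm_apply hc (differentiableAt_const _)]
  simp

/-- The tree's density is jointly `C^∞` in (departure, arrival) at a fixed time `t > 0`.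
[folklore] -/
theorem IsTransitionDensity.contDiff_uncurry_top {ω₂ lam β γ : ℝ} {T_L T_R : ℝ}
    {p : ℝ → PhaseSpace N → PhaseSpace N → ℝ} (hp : IsTransitionDensity ω₂ lam β γ N T_L T_R p)
    {t : ℝ} (ht : 0 < t) : ContDiff ℝ ∞ fun v : PhaseSpace N × PhaseSpace N => p t v.1 v.2 :=
  hp.1.comp_contDiff
    (f := fun v : PhaseSpace N × PhaseSpace N => ((t, v) : ℝ × PhaseSpace N × PhaseSpace N))
    (contDiff_prodMk_right t) fun _ => ⟨ht, Set.mem_univ _⟩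

/-- The tree's density is `C^∞` in the arrival point. [folklore] -/
theorem IsTransitionDensity.contDiff_right_top {ω₂ lam β γ : ℝ} {T_L T_R : ℝ}
    {p : ℝ → PhaseSpace N → PhaseSpace N → ℝ} (hp : IsTransitionDensity ω₂ lam β γ N T_L T_R p)
    {t : ℝ} (ht : 0 < t) (x : PhaseSpace N) : ContDiff ℝ ∞ (p t x) :=
  (hp.contDiff_uncurry_top ht).comp (contDiff_prodMk_right x)

/-- The tree's density is `C^∞` in the departure point. [folklore] -/
theorem IsTransitionDensity.contDiff_left_top {ω₂ lam β γ : ℝ} {T_L T_R : ℝ}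
    {p : ℝ → PhaseSpace N → PhaseSpace N → ℝ} (hp : IsTransitionDensity ω₂ lam β γ N T_L T_R p)
    {t : ℝ} (ht : 0 < t) (y : PhaseSpace N) : ContDiff ℝ ∞ fun x => p t x y :=
  (hp.contDiff_uncurry_top ht).comp (contDiff_prodMk_left y)

/-- **All derivatives of `P⁰_r h` under the integral sign** (`h ∈ C_c^∞`, `r > 0`, `p` a jointly
smooth density of the equal-temperature kernels): `y ↦ D^m_w (p(r, w, y) h(y))` is integrable and
`D^m (P⁰_r h)(w) = ∫ D^m_w (p(r, w, y) h(y)) dy` (local domination on `tsupport h × B̄(w₀, 1)`,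
`Literature.Analysis.FunctionSpaces.iteratedFDeriv_integral_of_dominated`). [folklore] -/
theorem integrable_and_iteratedFDeriv_eqKernelFun_eq {ω₂ lam β γ T : ℝ}
    {p : ℝ → PhaseSpace N → PhaseSpace N → ℝ} (hp : IsTransitionDensity ω₂ lam β γ N T T p)
    {h : PhaseSpace N → ℝ} (hh : ContDiff ℝ ∞ h) (hhc : HasCompactSupport h) {r : ℝ} (hr : 0 < r)
    (m : ℕ) (w : PhaseSpace N) :
    Integrable (fun y => iteratedFDeriv ℝ m (fun q => p r q y * h y) w) ∧
      iteratedFDeriv ℝ m (eqKernelFun ω₂ lam β γ T N h r) w =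
        ∫ y, iteratedFDeriv ℝ m (fun q => p r q y * h y) w := by
  have hG : ContDiff ℝ ∞ fun v : PhaseSpace N × PhaseSpace N => p r v.2 v.1 * h v.1 := by
    have h1 : ContDiff ℝ ∞ fun v : PhaseSpace N × PhaseSpace N => p r v.2 v.1 :=
      (hp.contDiff_uncurry_top hr).comp (contDiff_snd.prodMk contDiff_fst)
    exact h1.mul (hh.comp contDiff_fst)
  have hJ : ∀ m : ℕ, Continuous fun q : PhaseSpace N × PhaseSpace N =>
      iteratedFDeriv ℝ m (fun w : PhaseSpace N => p r w q.1 * h q.1) q.2 := fun m =>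
    (contDiff_iteratedFDeriv_section_right hG m).continuous
  have hfun : eqKernelFun ω₂ lam β γ T N h r = fun w => ∫ y, p r w y * h y := by
    funext w
    unfold eqKernelFun
    rw [hp.kernel_eq hr w, integral_withDensity_ofReal_phaseSpace
      (hp.contDiff_right hr w).continuous.measurable (hp.2.1 r hr w)]
  have hf : ∀ᵐ y ∂(volume : Measure (PhaseSpace N)),
      ContDiffOn ℝ ∞ (fun q : PhaseSpace N => p r q y * h y) univ :=
    Eventually.of_forall fun y => (hG.comp (contDiff_prodMk_right y)).contDiffOn
  have hmeas : ∀ m : ℕ, ∀ q ∈ (univ : Set (PhaseSpace N)), AEStronglyMeasurable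
      (fun y => iteratedFDeriv ℝ m (fun q : PhaseSpace N => p r q y * h y) q) volume :=
    fun m q _ => ((hJ m).comp (continuous_id.prodMk continuous_const)).aestronglyMeasurable
  have hdom : ∀ m : ℕ, ∀ w₀ ∈ (univ : Set (PhaseSpace N)), ∃ ε > 0, ∃ g : PhaseSpace N → ℝ,
      Integrable g ∧ ∀ᵐ y ∂(volume : Measure (PhaseSpace N)), ∀ q ∈ ball w₀ ε,
        ‖iteratedFDeriv ℝ m (fun q : PhaseSpace N => p r q y * h y) q‖ ≤ g y := by
    intro m w₀ _
    obtain ⟨C₀, hC₀⟩ :=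
      (hhc.isCompact.prod (isCompact_closedBall w₀ 1)).exists_bound_of_continuousOn
        (hJ m).continuousOn
    have hKm : MeasurableSet (tsupport h) := (isClosed_tsupport h).measurableSet
    refine ⟨1, one_pos, (tsupport h).indicator fun _ => max C₀ 0, ?_,
      Eventually.of_forall fun y q hq => ?_⟩
    · rw [integrable_indicator_iff hKm]
      exact integrableOn_const (hhc.isCompact.measure_lt_top).ne
    · by_cases hy : y ∈ tsupport h
      · rw [Set.indicator_of_mem hy]
        exact (hC₀ (y, q) ⟨hy, ball_subset_closedBall hq⟩).trans (le_max_left _ _)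
      · have h0 : (fun q : PhaseSpace N => p r q y * h y) = fun _ => 0 := by
          funext q
          rw [image_eq_zero_of_notMem_tsupport hy, mul_zero]
        rw [Set.indicator_of_notMem hy, h0, iteratedFDeriv_fun_zero, Pi.zero_apply, norm_zero]
  refine ⟨integrable_iteratedFDeriv_of_dominated hmeas hdom m (Set.mem_univ w), ?_⟩
  rw [hfun]
  exact iteratedFDeriv_integral_of_dominated isOpen_univ hf hmeas hdom m (Set.mem_univ w)

end Calculus

/-! ## 3. ★ (KD₂) ⟹ (G12*ᶜᶜ): two integrations by parts against the smooth density -/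

/-- ★ **(KD₂) ⟹ (G12*ᶜᶜ).**  With `P^δ_s(z, dy) = p(s, z, y) dy` (`p` smooth, from the tree) and
`G ∈ C_c²`: `∫ ∂_bG p = −∫ G ∂_{y_b}p` and `∫ ∂²_bG p = −∫ ∂_bG ∂_{y_b}p = ∫ G ∂²_{y_b}p` (no
boundary terms: every product is continuous with compact support), so both are
`≤ M ∫ e^{θ₁H}(|∂_{y_b}p| + |∂²_{y_b}p|) ≤ C M e^{θ₂H(z)}`.  `δ₀` is shrunk below `T` so that
both temperatures are positive. [cite: CuneoEckmannHairerReyBellet2018, Prop. 3.2] -/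
theorem perturbedKernelHessianIBPCompact_of_densitySobolev₂ (hK : LyapunovWeightedDensitySobolev₂) :
    PerturbedKernelHessianIBPCompact := by
  intro ω₂ lam β γ hω hl hβ hγ T hT N hN θ₁ θ₂ hθ₁ hθ₁₂ hθ₂
  obtain ⟨δ₀, C, hδ₀, hmain⟩ := hK ω₂ lam β γ hω hl hβ hγ T hT N hN θ₁ θ₂ hθ₁ hθ₁₂ hθ₂
  have hN0 : 0 < N := by omega
  refine ⟨min δ₀ T, C, lt_min hδ₀ hT, fun δ hδ s hs hs1 b hb M hM G hG hGc hGM z => ?_⟩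
  have hδ₀' : |δ| < δ₀ := lt_of_lt_of_le hδ (min_le_left _ _)
  have hδT : |δ| < T := lt_of_lt_of_le hδ (min_le_right _ _)
  have hL : 0 < T + δ / 2 := by linarith [neg_abs_le δ]
  have hR : 0 < T - δ / 2 := by linarith [le_abs_self δ]
  have hs0 : 0 < s := by linarith
  obtain ⟨p, hp⟩ := isTransitionDensity_exists hω hl.le hβ.le hγ hN0 hL hR.le
  obtain ⟨hint, hbound⟩ := hmain δ hδ₀' p hp s hs hs1 b hb z
  haveI := isAddHaarMeasure_volume_phaseSpace N
  set H : PhaseSpace N → ℝ := (pinnedChain ω₂ lam β γ).hamiltonian N with hH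
  set v : PhaseSpace N := ((0, Pi.single b 1) : PhaseSpace N) with hv
  -- the density slice and its bath-momentum derivatives
  set f₀ : PhaseSpace N → ℝ := p s z with hf₀
  have hf₀C : ContDiff ℝ ∞ f₀ := hp.contDiff_right_top hs0 z
  have hf₀d : Differentiable ℝ f₀ := hf₀C.differentiable (by simp)
  set f₁ : PhaseSpace N → ℝ := partialP b f₀ with hf₁
  have hf₁C : ContDiff ℝ ∞ f₁ := contDiff_partialP hf₀C (m := ∞) (by exact_mod_cast le_top) b
  have hf₁d : Differentiable ℝ f₁ := hf₁C.differentiable (by simp)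
  have hf₁e : ∀ y, fderiv ℝ f₀ y v = f₁ y := fun y => by rw [hf₁, partialP_eq_fderiv hf₀d b]
  have hf₂e : ∀ y, fderiv ℝ f₁ y v = partialP b f₁ y := fun y => by
    rw [partialP_eq_fderiv hf₁d b]
  -- the observable and its derivatives
  have hGd : Differentiable ℝ G := hG.differentiable (by norm_num)
  set g₁ : PhaseSpace N → ℝ := partialP b G with hg₁
  have hg₁C : ContDiff ℝ 1 g₁ := contDiff_one_partialP_of_contDiff_two b hG
  have hg₁d : Differentiable ℝ g₁ := hg₁C.differentiable one_ne_zero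
  have hg₁c : HasCompactSupport g₁ := hasCompactSupport_partialP hGd hGc b
  have hg₁e : ∀ y, fderiv ℝ G y v = g₁ y := fun y => by rw [hg₁, partialP_eq_fderiv hGd b]
  have hdGc : Continuous fun y => fderiv ℝ G y v :=
    (hG.continuous_fderiv (by norm_num)).clm_apply continuous_const
  have hdGs : HasCompactSupport fun y => fderiv ℝ G y v := hGc.fderiv_apply (𝕜 := ℝ) v
  have hdg₁c : Continuous fun y => fderiv ℝ g₁ y v :=
    (hg₁C.continuous_fderiv one_ne_zero).clm_apply continuous_const
  have hdg₁s : HasCompactSupport fun y => fderiv ℝ g₁ y v := hg₁c.fderiv_apply (𝕜 := ℝ) v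
  have hdf₀c : Continuous fun y => fderiv ℝ f₀ y v :=
    (hf₀C.continuous_fderiv (by simp)).clm_apply continuous_const
  have hdf₁c : Continuous fun y => fderiv ℝ f₁ y v :=
    (hf₁C.continuous_fderiv (by simp)).clm_apply continuous_const
  -- positivity and the weighted bounds of the two arrival terms
  have hE : ∀ y, 0 ≤ Real.exp (θ₁ * H y) := fun y => (Real.exp_pos _).le
  have hEc : Continuous fun y => Real.exp (θ₁ * H y) :=
    (continuous_const.mul (pinnedChain_continuous_hamiltonian ω₂ lam β γ N)).rexp
  obtain ⟨hI₁, hB₁⟩ := integrable_and_integral_le_of_le hint hbound hE (fun y => abs_nonneg _)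
    (fun y => (le_densitySobolevSum₂ p s b z y).2.1)
    (hEc.mul (continuous_partialP hf₀C (by simp) b).abs).aestronglyMeasurable
  obtain ⟨hI₂, hB₂⟩ := integrable_and_integral_le_of_le hint hbound hE (fun y => abs_nonneg _)
    (fun y => (le_densitySobolevSum₂ p s b z y).2.2)
    (hEc.mul (continuous_partialP hf₁C (by simp) b).abs).aestronglyMeasurable
  -- rewrite the kernel integrals as Lebesgue integrals against the density
  have hker : pertKernel ω₂ lam β γ T δ N s z = volume.withDensity fun y => ENNReal.ofReal (f₀ y) :=
    hp.kernel_eq hs0 z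
  rw [hker, integral_withDensity_ofReal_phaseSpace hf₀C.continuous.measurable (hp.2.1 s hs0 z),
    integral_withDensity_ofReal_phaseSpace hf₀C.continuous.measurable (hp.2.1 s hs0 z)]
  -- the generic weighted estimate `|∫ D · G| ≤ C M e^{θ₂H(z)}` for `D ∈ {∂_b f₀, ∂_b f₁}`
  have hest : ∀ D : PhaseSpace N → ℝ,
      Integrable (fun y => Real.exp (θ₁ * H y) * |D y|) →
      ∫ y, Real.exp (θ₁ * H y) * |D y| ≤ C * Real.exp (θ₂ * H z) →
      |∫ y, D y * G y| ≤ C * M * Real.exp (θ₂ * H z) := by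
    intro D hDi hDb
    rw [← Real.norm_eq_abs]
    calc ‖∫ y, D y * G y‖ ≤ ∫ y, M * (Real.exp (θ₁ * H y) * |D y|) := by
          refine norm_integral_le_of_norm_le (hDi.const_mul M) (Eventually.of_forall fun y => ?_)
          rw [Real.norm_eq_abs, abs_mul]
          calc |D y| * |G y| ≤ |D y| * (M * Real.exp (θ₁ * H y)) :=
                mul_le_mul_of_nonneg_left (hGM y) (abs_nonneg _)
            _ = M * (Real.exp (θ₁ * H y) * |D y|) := by ring
      _ = M * ∫ y, Real.exp (θ₁ * H y) * |D y| := integral_const_mul _ _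
      _ ≤ M * (C * Real.exp (θ₂ * H z)) := mul_le_mul_of_nonneg_left hDb hM
      _ = C * M * Real.exp (θ₂ * H z) := by ring
  constructor
  · -- first order: `∫ f₀ ∂_bG = −∫ ∂_b f₀ G`
    have e1 : (fun y => f₀ y * partialP b G y) = fun y => f₀ y * fderiv ℝ G y v := by
      funext y; rw [hg₁e y]
    have hibp := integral_mul_fderiv_eq_neg_fderiv_mul_of_integrable
      (μ := (volume : Measure (PhaseSpace N))) (f := f₀) (g := G) (v := v)
      ((hdf₀c.mul hG.continuous).integrable_of_hasCompactSupport hGc.mul_left)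
      ((hf₀C.continuous.mul hdGc).integrable_of_hasCompactSupport hdGs.mul_left)
      ((hf₀C.continuous.mul hG.continuous).integrable_of_hasCompactSupport hGc.mul_left)
      (fun y _ => hf₀d y) (fun y _ => hGd y)
    rw [e1, hibp, abs_neg]
    simp_rw [hf₁e]
    exact hest f₁ hI₁ hB₁
  · -- second order: `∫ f₀ ∂_b∂_bG = −∫ ∂_b f₀ ∂_bG = ∫ ∂_b∂_b f₀ G`
    have e1 : (fun y => f₀ y * partialP b (partialP b G) y) = fun y => f₀ y * fderiv ℝ g₁ y v := by
      funext y; rw [← hg₁, partialP_eq_fderiv hg₁d b]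
    have hibp₁ := integral_mul_fderiv_eq_neg_fderiv_mul_of_integrable
      (μ := (volume : Measure (PhaseSpace N))) (f := f₀) (g := g₁) (v := v)
      ((hdf₀c.mul hg₁C.continuous).integrable_of_hasCompactSupport hg₁c.mul_left)
      ((hf₀C.continuous.mul hdg₁c).integrable_of_hasCompactSupport hdg₁s.mul_left)
      ((hf₀C.continuous.mul hg₁C.continuous).integrable_of_hasCompactSupport hg₁c.mul_left)
      (fun y _ => hf₀d y) (fun y _ => hg₁d y)
    have e2 : (fun y => fderiv ℝ f₀ y v * g₁ y) = fun y => f₁ y * fderiv ℝ G y v := by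
      funext y; rw [hf₁e y, hg₁e y]
    have hibp₂ := integral_mul_fderiv_eq_neg_fderiv_mul_of_integrable
      (μ := (volume : Measure (PhaseSpace N))) (f := f₁) (g := G) (v := v)
      ((hdf₁c.mul hG.continuous).integrable_of_hasCompactSupport hGc.mul_left)
      ((hf₁C.continuous.mul hdGc).integrable_of_hasCompactSupport hdGs.mul_left)
      ((hf₁C.continuous.mul hG.continuous).integrable_of_hasCompactSupport hGc.mul_left)
      (fun y _ => hf₁d y) (fun y _ => hGd y)
    rw [e1, hibp₁, e2, hibp₂, neg_neg]
    simp_rw [hf₂e]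
    exact hest (partialP b f₁) hI₂ hB₂

/-! ## 4. ★ (KD₂) ⟹ (G2): the second derivative of `P⁰_r h` under the integral sign -/

/-- ★ **(KD₂) ⟹ (G2).**  For `h ∈ C_c^∞`, `r ∈ [½, 1]` and the tree's smooth density `p` of the
equal-temperature kernels (`δ = 0`):
`∂_{p_b}∂_{p_b} P⁰_r h (w) = D²(P⁰_r h)(w)(v,v) = ∫ D²_w(p(r,w,y)h(y))(v,v) dy
= ∫ h(y) ∂²_{x_b} p(r,·,y)(w) dy` (`integrable_and_iteratedFDeriv_eqKernelFun_eq`,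
`partialP_partialP_eq_iteratedFDeriv`), so `|∂²_b P⁰_r h(w)| ≤ C e^{θ'H(w)}`. [cite: CuneoEckmannHairerReyBellet2018, Prop. 3.2] -/
theorem equalTemperatureBathHessian_of_densitySobolev₂ (hK : LyapunovWeightedDensitySobolev₂) :
    EqualTemperatureBathHessian := by
  intro ω₂ lam β γ hω hl hβ hγ T hT N hN θ θ' hθ hθθ' hθ'
  obtain ⟨δ₀, C, hδ₀, hmain⟩ := hK ω₂ lam β γ hω hl hβ hγ T hT N hN θ θ' hθ hθθ' hθ'
  have hN0 : 0 < N := by omega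
  obtain ⟨p, hp⟩ := isTransitionDensity_exists hω hl.le hβ.le hγ hN0 hT hT.le
  have hp' : IsTransitionDensity ω₂ lam β γ N (T + 0 / 2) (T - 0 / 2) p := by simpa using hp
  refine ⟨C, fun r hr hr1 h hh hhc hhθ b hb w => ?_⟩
  have hr0 : 0 < r := by linarith
  obtain ⟨hint, hbound⟩ := hmain 0 (by simpa using hδ₀) p hp' r hr hr1 b hb w
  set H : PhaseSpace N → ℝ := (pinnedChain ω₂ lam β γ).hamiltonian N with hH
  set v : PhaseSpace N := ((0, Pi.single b 1) : PhaseSpace N) with hv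
  set mv : Fin 2 → PhaseSpace N := ![v, v] with hmv
  have h2 : ((2 : ℕ) : WithTop ℕ∞) ≤ ((⊤ : ℕ∞) : WithTop ℕ∞) := WithTop.coe_le_coe.2 le_top
  have hu : ContDiff ℝ 2 (eqKernelFun ω₂ lam β γ T N h r) :=
    (contDiff_eqKernelFun hω hl hβ hγ hT hN0 hh hhc hr0).of_le h2
  have hpy : ∀ y, ContDiff ℝ 2 fun x => p r x y := fun y => (hp.contDiff_left_top hr0 y).of_le h2
  -- the departure Hessian `D(y) = ∂²_{x_b} p(r,·,y)(w)` is continuous in `y`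
  set D : PhaseSpace N → ℝ := fun y => partialP b (partialP b fun x => p r x y) w with hD
  have hDe : ∀ y, iteratedFDeriv ℝ 2 (fun q => p r q y) w mv = D y := fun y =>
    (partialP_partialP_eq_iteratedFDeriv b (hpy y) w).symm
  have hDc : Continuous D := by
    have hG₀ : ContDiff ℝ ∞ fun q : PhaseSpace N × PhaseSpace N => p r q.2 q.1 :=
      (hp.contDiff_uncurry_top hr0).comp (contDiff_snd.prodMk contDiff_fst)
    have hJ : Continuous fun q : PhaseSpace N × PhaseSpace N =>
        iteratedFDeriv ℝ 2 (fun x : PhaseSpace N => p r x q.1) q.2 :=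
      (contDiff_iteratedFDeriv_section_right hG₀ 2).continuous
    have hi : Continuous fun y : PhaseSpace N => ((y, w) : PhaseSpace N × PhaseSpace N) :=
      continuous_id.prodMk continuous_const
    have hc := (continuous_eval_const mv).comp (hJ.comp hi)
    have e : D = fun y => iteratedFDeriv ℝ 2 (fun q : PhaseSpace N => p r q y) w mv :=
      funext fun y => (hDe y).symm
    rw [e]
    exact hc
  -- the formula `∂_b∂_b P⁰_r h (w) = ∫ h(y) D(y) dy`
  obtain ⟨hI, hform⟩ := integrable_and_iteratedFDeriv_eqKernelFun_eq hp hh hhc hr0 2 w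
  have h3 : ∀ y, iteratedFDeriv ℝ 2 (fun q => p r q y * h y) w mv = h y * D y := fun y => by
    have e : (fun q => p r q y * h y) = fun q => h y • p r q y :=
      funext fun q => by rw [smul_eq_mul, mul_comm]
    rw [e, iteratedFDeriv_const_smul_apply' (hpy y).contDiffAt, smul_apply, smul_eq_mul, hDe y]
  have hformula : partialP b (partialP b (eqKernelFun ω₂ lam β γ T N h r)) w = ∫ y, h y * D y := by
    rw [partialP_partialP_eq_iteratedFDeriv b hu w, hform,
      ContinuousMultilinearMap.integral_apply hI]
    exact integral_congr_ae (Eventually.of_forall h3)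
  -- the weighted bound of the departure Hessian term of (KD₂)
  have hE : ∀ y, 0 ≤ Real.exp (θ * H y) := fun y => (Real.exp_pos _).le
  have hEc : Continuous fun y => Real.exp (θ * H y) :=
    (continuous_const.mul (pinnedChain_continuous_hamiltonian ω₂ lam β γ N)).rexp
  obtain ⟨hI₂, hB₂⟩ := integrable_and_integral_le_of_le hint hbound hE (fun y => abs_nonneg _)
    (fun y => (le_densitySobolevSum₂ p r b w y).1) (hEc.mul hDc.abs).aestronglyMeasurable
  rw [hformula, ← Real.norm_eq_abs]
  calc ‖∫ y, h y * D y‖ ≤ ∫ y, Real.exp (θ * H y) * |D y| := by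
        refine norm_integral_le_of_norm_le hI₂ (Eventually.of_forall fun y => ?_)
        rw [Real.norm_eq_abs, abs_mul]
        exact mul_le_mul_of_nonneg_right (hhθ y) (abs_nonneg _)
    _ ≤ C * Real.exp (θ' * H w) := hB₂

/-! ## 5. The junctions through (KD₂) -/

/-- ★★ **S3 ⟸ (Dˢ) ∧ (KD₂)**: the Duhamel identity on the smooth compactly supported class and the
fixed-time Lyapunov-weighted `W^{2,1}` bound of the tree's hypoelliptic density give
`KernelTemperatureLipschitz` — through (G2) (departure side, `δ = 0`) and (G12*ᶜᶜ) ⟹ (G2*)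
(arrival side). [cite: CuneoEckmannHairerReyBellet2018, §3 eq. (3.2), (3.4), Prop. 3.2] -/
theorem kernelTemperatureLipschitz_of_densitySobolev₂ (hD : KernelTemperatureDuhamelSmooth)
    (hK : LyapunovWeightedDensitySobolev₂) : KernelTemperatureLipschitz :=
  kernelTemperatureLipschitz_of_hessianSplitCompact hD
    (equalTemperatureBathHessian_of_densitySobolev₂ hK)
    (perturbedKernelHessianIBPCompact_of_densitySobolev₂ hK)

/-- ★ **The junction `K_fix ⟸ A0 ∧ A2 ∧ (Dˢ) ∧ (KD₂) ∧ A3p ∧ A4`.**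
[cite: CuneoEckmannHairerReyBellet2018, §3 eq. (3.2), (3.4), Prop. 3.2, Thm 4.1] -/
theorem snapshotKLUpperExpansion_of_atoms₆KD (h0 : NessGibbsReweighting)
    (h2 : NessOddLogRatioBound) (hD : KernelTemperatureDuhamelSmooth)
    (hK : LyapunovWeightedDensitySobolev₂) (h3p : NessFloorMeanValue)
    (h4 : NessLinearResponseL2) : SnapshotKLUpperExpansion :=
  snapshotKLUpperExpansion_of_atoms₈Hc h0 h2 hD (equalTemperatureBathHessian_of_densitySobolev₂ hK)
    (perturbedKernelHessianIBPCompact_of_densitySobolev₂ hK) h3p h4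

end Summit.AtomisticToContinuum.FouriersLaw.Theorems.ExtensiveSnapshotIrreversibility.EnergyWindow

end
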